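import Mathlib
import Summits.Ventures.PercRepro2.Defs
import Summits.Ventures.PercRepro2.DisagreementSum

/-!
# Pinned disagreement sums are weight-free complementary-pair counts
(blind cell PercRepro2, p1; `proofs/P1-TWOCOPY.md` §2)

When every edge off `G` is pinned (`q e ∈ {0, 1}`), the disagreement sum of a kernel `K` is

  `disSum q G K = (∏_{e ∈ G} q e (1 − q e)) · ∑_{x : x = z off G} K x (flipOn G x)`,

where `z` is the pinned configuration (`z e = true ↔ q e = 1`) and `flipOn G x` complements `x` on
`G` (`disSum_pinned_eq`). So the base hypothesis of `disSum_nonneg_of_pinned` is exactly the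
nonnegativity of the complementary-pair counts `pinnedCount` on every minor `(G, z)` — a statement
about 2-colourings of the edges of `G` (red = `x`, blue = `flipOn G x`), with no weights at all
(`disSum_nonneg_of_pinnedCount`).
-/

namespace Summit.Ventures.PercRepro2

section Flip

variable {E : Type*} [DecidableEq E]

/-- Complement a configuration on the edges of `G`. -/
def flipOn (G : Finset E) (x : Config E) : Config E := fun e => if e ∈ G then !x e else x e

/-- `flipOn` on an edge of `G`. -/
@[simp] lemma flipOn_of_mem (G : Finset E) (x : Config E) {e : E} (he : e ∈ G) :
    flipOn G x e = !x e := by simp [flipOn, he]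

/-- `flipOn` off `G`. -/
@[simp] lemma flipOn_of_notMem (G : Finset E) (x : Config E) {e : E} (he : e ∉ G) :
    flipOn G x e = x e := by simp [flipOn, he]

/-- `x` and `flipOn G x` disagree exactly on `G`. -/
lemma flipOn_ne (G : Finset E) (x : Config E) {e : E} (he : e ∈ G) : x e ≠ flipOn G x e := by
  rw [flipOn_of_mem G x he]
  cases x e <;> simp

end Flip

section PinnedEval

variable {E : Type*} [Fintype E] [DecidableEq E] {R : Type*} [CommRing R] [Nontrivial R]
  [DecidableEq R]

/-- The pinned configuration of a weight vector: `e` is open iff `q e = 1`. -/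
def pinnedConfig (q : E → R) : Config E := fun e => decide (q e = 1)

/-- The weight-free complementary-pair count of a kernel on the minor `(G, z)`:
`∑_{x : x = z off G} K x (flipOn G x)`. -/
def pinnedCount (G : Finset E) (z : Config E) (K : Config E → Config E → R) : R :=
  ∑ x : Config E, if (∀ e, e ∉ G → x e = z e) then K x (flipOn G x) else 0

/-- A pinned edge factor is `1` on the pinned value and `0` otherwise. -/
lemma edgeFactor_pinned {q : R} (hq : q = 0 ∨ q = 1) (b : Bool) :
    edgeFactor q b = if b = decide (q = 1) then 1 else 0 := by
  rcases hq with rfl | rfl <;> cases b <;> simp [edgeFactor]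

/-- The weight of a configuration under a weight vector pinned off `G` factors as the product of
the `G`-factors times the indicator that the configuration equals the pinned one off `G`. -/
lemma weight_eq_of_pinned (q : E → R) (G : Finset E) (hq : ∀ e, e ∉ G → q e = 0 ∨ q e = 1)
    (x : Config E) :
    weight q x = (∏ e ∈ G, edgeFactor (q e) (x e)) *
      (if (∀ e, e ∉ G → x e = pinnedConfig q e) then 1 else 0) := by
  unfold weight
  rw [← Finset.prod_mul_prod_compl G]
  congr 1
  by_cases hx : ∀ e, e ∉ G → x e = pinnedConfig q e
  · rw [if_pos hx]
    refine Finset.prod_eq_one fun e he => ?_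
    have he' : e ∉ G := Finset.mem_compl.mp he
    rw [edgeFactor_pinned (hq e he')]
    exact if_pos (hx e he')
  · rw [if_neg hx]
    rw [not_forall] at hx
    obtain ⟨e, he⟩ := hx
    rw [Classical.not_imp] at he
    obtain ⟨he, hne⟩ := he
    refine Finset.prod_eq_zero (Finset.mem_compl.mpr he) ?_
    rw [edgeFactor_pinned (hq e he)]
    exact if_neg hne

omit [Nontrivial R] [DecidableEq R] in
/-- The two factors of an edge at complementary values multiply to `q (1 − q)`. -/
lemma edgeFactor_mul_edgeFactor_not (q : R) (b : Bool) :
    edgeFactor q b * edgeFactor q (!b) = q * (1 - q) := by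
  cases b <;> simp [edgeFactor, mul_comm]

/-- Under a weight vector pinned off `G`, two configurations that disagree on `G` and both carry
weight are complementary on `G`. -/
lemma eq_flipOn_of_pinned (q : E → R) (G : Finset E) (hq : ∀ e, e ∉ G → q e = 0 ∨ q e = 1)
    {x y : Config E} (hxy : ∀ e ∈ G, x e ≠ y e) (hx : weight q x ≠ 0) (hy : weight q y ≠ 0) :
    y = flipOn G x := by
  rw [weight_eq_of_pinned q G hq] at hx hy
  have hx' : ∀ e, e ∉ G → x e = pinnedConfig q e := by
    by_contra h
    simp [h] at hx
  have hy' : ∀ e, e ∉ G → y e = pinnedConfig q e := by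
    by_contra h
    simp [h] at hy
  funext e
  by_cases he : e ∈ G
  · rw [flipOn_of_mem G x he]
    have := hxy e he
    cases hxe : x e <;> cases hye : y e <;> simp_all
  · rw [flipOn_of_notMem G x he, hx' e he, hy' e he]

/-- **Pinned evaluation**: with every edge off `G` pinned, the disagreement sum is the product of
the `G`-factors `q e (1 − q e)` times the weight-free complementary-pair count on the minor
`(G, pinnedConfig q)`. -/
theorem disSum_pinned_eq (q : E → R) (G : Finset E) (hq : ∀ e, e ∉ G → q e = 0 ∨ q e = 1)
    (K : Config E → Config E → R) :
    disSum q G K = (∏ e ∈ G, q e * (1 - q e)) * pinnedCount G (pinnedConfig q) K := by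
  unfold disSum pinnedCount
  rw [Finset.mul_sum]
  refine Finset.sum_congr rfl fun x _ => ?_
  -- the inner sum over `y` collapses to `y = flipOn G x`
  have hcollapse : (∑ y : Config E, if ∀ e ∈ G, x e ≠ y e then weight q x * weight q y * K x y else 0)
      = weight q x * weight q (flipOn G x) * K x (flipOn G x) := by
    rw [Finset.sum_eq_single (flipOn G x)]
    · rw [if_pos (fun e he => flipOn_ne G x he)]
    · intro y _ hy
      by_cases hxy : ∀ e ∈ G, x e ≠ y e
      · rw [if_pos hxy]
        by_cases hx : weight q x = 0
        · simp [hx]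
        by_cases hy0 : weight q y = 0
        · simp [hy0]
        exact absurd (eq_flipOn_of_pinned q G hq hxy hx hy0) hy
      · rw [if_neg hxy]
    · intro h
      exact absurd (Finset.mem_univ _) h
  rw [hcollapse, weight_eq_of_pinned q G hq x, weight_eq_of_pinned q G hq (flipOn G x)]
  have hflip : (∀ e, e ∉ G → flipOn G x e = pinnedConfig q e) ↔
      (∀ e, e ∉ G → x e = pinnedConfig q e) := by
    constructor
    · intro h e he
      have := h e he
      rwa [flipOn_of_notMem G x he] at this
    · intro h e he
      rw [flipOn_of_notMem G x he]
      exact h e he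
  by_cases hx : ∀ e, e ∉ G → x e = pinnedConfig q e
  · rw [if_pos hx, if_pos (hflip.mpr hx), if_pos hx]
    have hprod : (∏ e ∈ G, edgeFactor (q e) (x e)) * (∏ e ∈ G, edgeFactor (q e) (flipOn G x e)) =
        ∏ e ∈ G, q e * (1 - q e) := by
      rw [← Finset.prod_mul_distrib]
      refine Finset.prod_congr rfl fun e he => ?_
      rw [flipOn_of_mem G x he, edgeFactor_mul_edgeFactor_not]
    calc (∏ e ∈ G, edgeFactor (q e) (x e)) * 1 *
          ((∏ e ∈ G, edgeFactor (q e) (flipOn G x e)) * 1) * K x (flipOn G x)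
        = ((∏ e ∈ G, edgeFactor (q e) (x e)) * (∏ e ∈ G, edgeFactor (q e) (flipOn G x e))) *
            K x (flipOn G x) := by ring
      _ = (∏ e ∈ G, q e * (1 - q e)) * K x (flipOn G x) := by rw [hprod]
  · rw [if_neg hx, if_neg (fun h => hx (hflip.mp h)), if_neg hx]
    ring

end PinnedEval

section Reduction

variable {E : Type*} [Fintype E] [DecidableEq E] {R : Type*} [CommRing R] [LinearOrder R]
  [IsStrictOrderedRing R]

omit [Fintype E] [DecidableEq E] in
/-- The `G`-factors of a weight vector with values in `[0, 1]` are nonnegative. -/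
lemma prod_weight_factors_nonneg (q : E → R) (hq : ∀ e, 0 ≤ q e ∧ q e ≤ 1) (G : Finset E) :
    0 ≤ ∏ e ∈ G, q e * (1 - q e) :=
  Finset.prod_nonneg fun e _ => mul_nonneg (hq e).1 (sub_nonneg.mpr (hq e).2)

/-- **Reduction to complementary-pair counts**: if the weight-free count `pinnedCount G z K` is
nonnegative for every minor `(G, z)`, then every disagreement sum of `K` is nonnegative for every
weight vector with values in `[0, 1]` (so the one-copy inequality `F = ∅` and all its two-copy
forms hold). -/
theorem disSum_nonneg_of_pinnedCount (K : Config E → Config E → R)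
    (hcount : ∀ (G : Finset E) (z : Config E), 0 ≤ pinnedCount G z K)
    (p : E → R) (hp : ∀ e, 0 ≤ p e ∧ p e ≤ 1) (F : Finset E) : 0 ≤ disSum p F K := by
  refine disSum_nonneg_of_pinned K (fun q G hq hpin => ?_) p hp F
  rw [disSum_pinned_eq q G hpin K]
  exact mul_nonneg (prod_weight_factors_nonneg q hq G) (hcount G (pinnedConfig q))

end Reduction

end Summit.Ventures.PercRepro2
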